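/-
Copyright (c) 2026 the pub-hodgecm-mathlib formalisation cell (harness21).  Prover seat hodgecm-mathlib-LH7-p05 (g2) on the CHAIR K2-lead VALVE,
Track B «K2-LIT» ∕ hLiu418 #184♮ = `stmt-HodgeConjecture-24832`, Road I v3, FACE-G road (E), brick (E-g-fin) 𝓢-side — THE `hfin` CLOSER of ★ p863527
`K2LiuArchSWPolynomialPartner` (F4 DESK K2Liu-p27 (g2) 00:20:18Z: «(α)(γ) of your `hfin` bridge stay with you by lineage»).  THEOREMS ONLY (no `def`, no `instance`,
no notation, no named-fact hypothesis, no `sorry`); lane `--supports stmt-HodgeConjecture-24832 --as helper`.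
-/
import Summits.HodgeConjecture.HodgeConjecture.Theorems.K2LiuArchSWPolynomialPartner   -- ★ p863527 (E-g) HEAD: `partner_letter_of_finiteRange` (modulo `hfin`)
import Summits.HodgeConjecture.HodgeConjecture.Theorems.K2LiuMatrixCoeffFiniteType     -- ★ p863624 (β): `finiteDimensional_span_matrixCoeff`, `matrixCoeff_comp_mem_span`
import Summits.HodgeConjecture.HodgeConjecture.Theorems.K2LiuTensorEmbArchFinParts     -- ★ U2f for standard data: `finiteDimensional_span_orbit_of_mem_span_tmul_of_isStd`
import Literature.NumberTheory.K2Lit.SiegelWeilSectionTensor                           -- ★ `swSectionTensor`, `isSiegelDeltaSection_swSectionTensor`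
import Summits.HodgeConjecture.HodgeConjecture.Theorems.K2LiuSiegelWeilTensorGenerator     -- ★ `swSectionTensor_mul_right` (`f_Φ(h k) = f_{ω(sB(k ⊗ 1))Φ}(h)`)
import HarnessLib

/-!
# Crux `HLiu418`, FACE-G road (E), (E-g-fin) 𝓢-side: THE SIEGEL–WEIL SECTIONS OF ALL DEGREE TRUNCATIONS OF AN ARCH-STABLE FINITE-DIMENSIONAL `V` SPAN A
# FINITE-DIMENSIONAL SPACE — the `hfin` letter of ★ p863527 DISCHARGED for standard Iwasawa data, modulo the one ARCH-LEG READING letter `hread`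

Cell `hodgecm-mathlib`, crux item hLiu418 = `stmt-HodgeConjecture-24832` (helper lane, count-neutral; closes no socket).  Namespace
`Summit.HodgeConjecture.HodgeConjecture.Cruxes.HLiu418.K2LiuArchSWTruncationSectionsFinite`.

THE ARGUMENT (no compact-picture carriers, no K-types — (γ) and ★ p863082 are BYPASSED; (α) is replaced by the Iwasawa decomposition of the SMALL group).
Write `Π(h) := ω(sB(h ⊗ 1))` (the big doubled Weil representation read along ★ `tensorEmb`), `E := piSchwartzBruhatEquiv`, `Tr_N` = ★ p863184's degree truncation of
the big Folland frame `frameD′`, `P_N := Tr_N ⊗ 1 = adelicTensorEnd Tr_N id`, and `λ` — a LINEAR functional with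
`swSectionTensor sB Φ h = λ (Π(h) Φ)` where NOW `λ Ψ := swSectionTensor sB Ψ 1` (★ `swSectionTensor_mul_right` at `h = 1·h`; linear by ★ `swSectionTensor_add∕_smul`).
1. (Iwasawa, ★ `IwasawaDatum.iwasawa` + ★ `isSiegelDeltaSection_swSectionTensor`) every `swSectionTensor sB Φ` is a Siegel section of `I((3 − n)/2, χ_b³)`, hence is the image
   of its restriction to `𝒦.K` under ONE linear map `M : (𝒦.K → ℂ) →ₗ (H(𝔸) → ℂ)`, `(Mψ)(h) = χ_s(p(h)) ψ(k(h))` for a fixed choice `h = p(h) k(h)`.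
2. (★ U2f, `K2LiuTensorEmbArchFinParts.finiteDimensional_span_orbit_of_mem_span_tmul_of_isStd`) for `𝒦` standard and `V` finite-dimensional with ★ `IsArchStable … 𝒦 V`, the
   `Π(𝒦.K)`-orbit of every `E(v ⊗ f)`, `v ∈ V`, spans a finite-dimensional space; so `U := Σ_i orbitSpan (E(b_i ⊗ f))` over a basis `b` of `V` is finite-dimensional,
   `Π(𝒦.K)`-stable, and contains every `E(v ⊗ f)`, `v ∈ V`.
3. (the letter `hread`, by value) for `k ∈ 𝒦.K`: `Π(k) E(a ⊗ φ) = c_k • E((x_k • a) ⊗ B_k φ)` with `x_k ∈ Mp^𝓢` over a unitary (★ `omega_sD_tmul_eq` + ★ `omega_sD_archToAdelic_tmul`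
   at the big datum + ★ p863113 plumbing + compactness ⇒ unitarity); with ★ p863184 `degTrunc_carrierConjEquiv_of_proj_eq_realifySp` (`Tr_N x_k = x_k Tr_N`) this gives
   `P_N Π(k) = Π(k) P_N` on pure tensors, hence everywhere (`TensorProduct.ext'`).
4. (★ (β) `matrixCoeff_comp_mem_span` + `finiteDimensional_span_matrixCoeff`) the restriction `k ↦ λ(Π(k) E(Tr_N v ⊗ f)) = λ(Π(k) P_N E(v ⊗ f)) = (λ ∘ P_N)(Π(k) E(v ⊗ f))` is a
   matrix coefficient of the ONE finite-dimensional stable `U` — for EVERY `N` — so all restrictions lie in the finite-dimensional `MC(U)`, and all sections in `M(MC(U))`.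
* §1 **`finiteDimensional_span_truncationSections`** (= the `hfin` letter of ★ p863527, for `𝒦` standard, from `hread`); §2 **`partner_letter_of_isStd`** — ★ p863249's `hpartner` binder at `t := follandHermite frameD′` from `h𝒦 : 𝒦.IsStd`
  and `hread` alone (★ p863527 `partner_letter_of_finiteRange` ∘ §1).
References: [KudlaRallis1994, §1 Thm. 1.1 (Siegel–Weil sections, `K`-finiteness)]; [HarrisKudlaSweet1996, §1 (1.15)–(1.17)]; [Tan1999, §1 p. 166]; [BorelJacquet1979, §4.1];
[Knapp1986, Ch. VII §1]; [Folland1989, §1.7 (1.81), §4.2 Prop. (4.39)]; [Howe1989, §3].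
HONEST LABEL: HC_CM is proved only modulo the 7 printed citations (2 remaining named inputs: hLiu418 = stmt-HodgeConjecture-24832, h413 = stmt-HodgeConjecture-24833) until
rung 0 closes; count-neutral helper (`--supports stmt-HodgeConjecture-24832 --as helper`), closes no socket, moves no counter.
-/

set_option autoImplicit false
set_option linter.dupNamespace false -- the mandated namespace repeats `HodgeConjecture.HodgeConjecture`

noncomputable section

open scoped Matrix TensorProduct SchwartzMap Classical
open NumberField NumberField.mixedEmbedding IsDedekindDomain Filter Topology
open Literature.NumberTheory.Automorphic Literature.NumberTheory.Automorphic.UnitaryGroup Literature.NumberTheory.GaloisRepresentations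
open Literature.NumberTheory.GelbartRogawski1991 Literature.NumberTheory.GelbartRogawski1991.GRConstruction
open Literature.NumberTheory.Automorphic.Liu2021.Def411WeilCarriersDoubling
open Literature.NumberTheory.Weil1964 Literature.Analysis.SegalBargmann Literature.RepresentationTheory.HeisenbergGroup
open Literature.NumberTheory.K2Lit.SiegelDoubled
open Summit.HodgeConjecture.HodgeConjecture.Cruxes.HLiu418.K2LiuFaceGLetterDefs (genFamily IsArchStable)
open Summit.HodgeConjecture.HodgeConjecture.Cruxes.HLiu418.K2LiuArchSWDegreeTruncation (degTrunc_carrierConjEquiv_of_proj_eq_realifySp)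
open Summit.HodgeConjecture.HodgeConjecture.Cruxes.HLiu418.K2LiuMatrixCoeffFiniteType (finiteDimensional_span_matrixCoeff matrixCoeff_comp_mem_span)
open Summit.HodgeConjecture.HodgeConjecture.Cruxes.HLiu418.K2LiuTensorEmbArchFinParts (finiteDimensional_span_orbit_of_mem_span_tmul_of_isStd)
open Summit.HodgeConjecture.HodgeConjecture.Cruxes.HLiu418.K2LiuArchSWPolynomialPartner (partner_letter_of_finiteRange)

namespace Summit.HodgeConjecture.HodgeConjecture.Cruxes.HLiu418.K2LiuArchSWTruncationSectionsFinite

variable (L : Type) [Field L] [NumberField L] [IsCMField L] {n : ℕ} (e : Fin 2 × Fin 1 ≃ Fin n)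
  (dV : Fin 2 → L) (hdV : ∀ i, IsCMField.complexConj L (dV i) = dV i) (hdV0 : ∀ i, dV i ≠ 0)
  (dW : Fin 1 → L) (hdW : ∀ i, IsCMField.complexConj L (dW i) = dW i) (hdW0 : ∀ i, dW i ≠ 0)
  {M' n' : ℕ} (eW : Fin 1 × Fin 3 ≃ Fin M') (e' : Fin 2 × Fin M' ≃ Fin n')
  (dV' : Fin 3 → L) (hdV' : ∀ k, IsCMField.complexConj L (dV' k) = dV' k) (hdV'0 : ∀ k, dV' k ≠ 0)
  (χb : HeckeCharacter L) (hχbu : χb.IsUnitary) (hχbs : Literature.RepresentationTheory.HarrisKudlaSweet1996.IsSplittingChar L 1 χb)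
  (α : UnitaryGroup.adelicOne (Fp L) L (IsCMField.complexConj L) →* ℂˣ) (𝒦 : IwasawaDatum L e dV hdV dW hdW)

/-! ## §1 THE `hfin` LETTER OF ★ p863527, DISCHARGED (standard `𝒦`, modulo the arch-leg reading `hread`) -/

/-- **THE SIEGEL–WEIL SECTIONS OF ALL DEGREE TRUNCATIONS OF AN ARCH-STABLE FINITE-DIMENSIONAL `V` SPAN A FINITE-DIMENSIONAL SPACE** — the `hfin` letter of ★ p863527
`exists_fockFinite_partner_of_finiteRange`, bytes verbatim, for a STANDARD Iwasawa datum (`h𝒦`), from the one ARCH-LEG READING letter `hread` (for every `k ∈ 𝒦.K` the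
operator `ω(sB(k ⊗ 1))` is `c • (x_k • ·) ⊗ B_k` on pure tensors with `x_k ∈ Mp^𝓢` over a unitary — ★ `omega_sD_tmul_eq` + ★ `omega_sD_archToAdelic_tmul` + ★ p863113, by value).
Steps 1–4 of the module docstring. [cite: KudlaRallis1994, §1 Thm. 1.1] [cite: HarrisKudlaSweet1996, §1 (1.15)–(1.17)] [cite: Tan1999, §1 p. 166] [cite: Knapp1986, Ch. VII §1]
[cite: Folland1989, §4.2 Prop. (4.39)] -/
theorem finiteDimensional_span_truncationSections (h𝒦 : 𝒦.IsStd)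
    (hread : ∀ k ∈ 𝒦.K, ∃ (x : MpS (Fin (n' + n') × {v : InfinitePlace (Fp L) // v.IsReal}))
      (u : Matrix.unitaryGroup (Fin (n' + n') × {v : InfinitePlace (Fp L) // v.IsReal}) ℂ) (c : ℂ)
      (B : FinSB (Fp L) (Fin (n' + n')) →ₗ[ℂ] FinSB (Fp L) (Fin (n' + n'))),
      MpS.proj x = realifySp (Fin (n' + n') × {v : InfinitePlace (Fp L) // v.IsReal}) u ∧
      ∀ (a : 𝓢(((Fin (n' + n')) → mixedSpace (Fp L)), ℂ)) (φ : FinSB (Fp L) (Fin (n' + n'))),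
        adelicMpCont.omega (Fp L) (Fin (n' + n')) (gramDA L e' dV hdV (tensorFrame L dW eW dV') (tensorFrame_real L dW hdW eW dV' hdV'))
            ((doubledWeilRep L e' dV hdV hdV0 (tensorFrame L dW eW dV') (tensorFrame_real L dW hdW eW dV' hdV')
                  (tensorFrame_ne_zero L dW eW dV' hdW0 hdV'0) χb hχbu hχbs) (tensorEmb L e dV hdV dW hdW eW e' dV' hdV' k))
            (piSchwartzBruhatEquiv (Fp L) (Fin (n' + n')) (a ⊗ₜ[ℂ] φ)) =
          c • piSchwartzBruhatEquiv (Fp L) (Fin (n' + n'))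
            (carrierConjEquiv (frameD L e' dV hdV hdV0 (tensorFrame L dW eW dV') (tensorFrame_real L dW hdW eW dV' hdV')
                (tensorFrame_ne_zero L dW eW dV' hdW0 hdV'0)) x.1.2 a ⊗ₜ[ℂ] B φ))
    (V : Submodule ℂ 𝓢(((Fin (n' + n')) → mixedSpace (Fp L)), ℂ)) [FiniteDimensional ℂ V]
    (hVst : IsArchStable L e dV hdV hdV0 dW hdW hdW0 eW e' dV' hdV' hdV'0 χb hχbu hχbs 𝒦 V) (f : FinSB (Fp L) (Fin (n' + n'))) :
    FiniteDimensional ℂ ↥(Submodule.span ℂ {φ : HA L e dV hdV dW hdW → ℂ | ∃ (N : ℕ) (v : 𝓢(((Fin (n' + n')) → mixedSpace (Fp L)), ℂ)), v ∈ V ∧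
      φ = fun h => swSectionTensor L e dV hdV dW hdW eW e' dV' hdV' hdV0 hdW0 hdV'0
        (doubledWeilRep L e' dV hdV hdV0 (tensorFrame L dW eW dV') (tensorFrame_real L dW hdW eW dV' hdV')
          (tensorFrame_ne_zero L dW eW dV' hdW0 hdV'0) χb hχbu hχbs)
        (piSchwartzBruhatEquiv (Fp L) (Fin (n' + n'))
          ((schwartzTransport (frameD L e' dV hdV hdV0 (tensorFrame L dW eW dV') (tensorFrame_real L dW hdW eW dV' hdV')
              (tensorFrame_ne_zero L dW eW dV' hdW0 hdV'0))).symm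
            (schwartzTransport (euclE (Fin (n' + n') × {v : InfinitePlace (Fp L) // v.IsReal}))
              (∑ d ∈ Finset.range N, degProjS d
                ((schwartzTransport (euclE (Fin (n' + n') × {v : InfinitePlace (Fp L) // v.IsReal}))).symm
                  (schwartzTransport (frameD L e' dV hdV hdV0 (tensorFrame L dW eW dV') (tensorFrame_real L dW hdW eW dV' hdV')
                    (tensorFrame_ne_zero L dW eW dV' hdW0 hdV'0)) v)))) ⊗ₜ[ℂ] f)) h}) := by
  -- notation-free local abbreviations (no definitions)
  let ω := adelicMpCont.omega (Fp L) (Fin (n' + n')) (gramDA L e' dV hdV (tensorFrame L dW eW dV') (tensorFrame_real L dW hdW eW dV' hdV'))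
  let sB := doubledWeilRep L e' dV hdV hdV0 (tensorFrame L dW eW dV') (tensorFrame_real L dW hdW eW dV' hdV')
    (tensorFrame_ne_zero L dW eW dV' hdW0 hdV'0) χb hχbu hχbs
  have hsB := isDoubledWeilRep_doubledWeilRep L e' dV hdV hdV0 (tensorFrame L dW eW dV') (tensorFrame_real L dW hdW eW dV' hdV')
    (tensorFrame_ne_zero L dW eW dV' hdW0 hdV'0) χb hχbu hχbs
  let R : HA L e dV hdV dW hdW → Module.End ℂ ↥(piSchwartzBruhat (Fp L) (Fin (n' + n'))) := fun h =>
    ω (sB (tensorEmb L e dV hdV dW hdW eW e' dV' hdV' h))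
  let E := piSchwartzBruhatEquiv (Fp L) (Fin (n' + n'))
  let fr := frameD L e' dV hdV hdV0 (tensorFrame L dW eW dV') (tensorFrame_real L dW hdW eW dV' hdV') (tensorFrame_ne_zero L dW eW dV' hdW0 hdV'0)
  -- `Π` is multiplicative and unital
  have hRmul : ∀ (k k' : HA L e dV hdV dW hdW) (Ψ : piSchwartzBruhat (Fp L) (Fin (n' + n'))), R (k * k') Ψ = R k (R k' Ψ) := fun k k' Ψ =>
    LinearMap.congr_fun (show R (k * k') = R k * R k' by simp only [R, map_mul]) Ψ
  have hRone : ∀ Ψ : piSchwartzBruhat (Fp L) (Fin (n' + n')), R 1 Ψ = Ψ := fun Ψ =>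
    LinearMap.congr_fun (show R 1 = 1 by simp only [R, map_one]) Ψ
  -- the truncations `Tr_N` as continuous linear maps and `P_N := Tr_N ⊗ 1`
  let T₁ : 𝓢(((Fin (n' + n')) → mixedSpace (Fp L)), ℂ) →L[ℂ] 𝓢((Fin (n' + n') × {v : InfinitePlace (Fp L) // v.IsReal} → ℝ), ℂ) := schwartzTransport fr
  let T₂ : 𝓢((Fin (n' + n') × {v : InfinitePlace (Fp L) // v.IsReal} → ℝ), ℂ) →L[ℂ]
      𝓢(EuclideanSpace ℝ (Fin (n' + n') × {v : InfinitePlace (Fp L) // v.IsReal}), ℂ) :=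
    (schwartzTransport (euclE (Fin (n' + n') × {v : InfinitePlace (Fp L) // v.IsReal}))).symm
  let T₄ : 𝓢(EuclideanSpace ℝ (Fin (n' + n') × {v : InfinitePlace (Fp L) // v.IsReal}), ℂ) →L[ℂ]
      𝓢((Fin (n' + n') × {v : InfinitePlace (Fp L) // v.IsReal} → ℝ), ℂ) :=
    schwartzTransport (euclE (Fin (n' + n') × {v : InfinitePlace (Fp L) // v.IsReal}))
  let T₅ : 𝓢((Fin (n' + n') × {v : InfinitePlace (Fp L) // v.IsReal} → ℝ), ℂ) →L[ℂ] 𝓢(((Fin (n' + n')) → mixedSpace (Fp L)), ℂ) := (schwartzTransport fr).symm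
  let Tr : ℕ → (𝓢(((Fin (n' + n')) → mixedSpace (Fp L)), ℂ) →L[ℂ] 𝓢(((Fin (n' + n')) → mixedSpace (Fp L)), ℂ)) := fun N =>
    T₅.comp (T₄.comp ((∑ d ∈ Finset.range N, degProjS d).comp (T₂.comp T₁)))
  have hTr : ∀ (N : ℕ) (b : 𝓢(((Fin (n' + n')) → mixedSpace (Fp L)), ℂ)), Tr N b = (schwartzTransport fr).symm
      (schwartzTransport (euclE (Fin (n' + n') × {v : InfinitePlace (Fp L) // v.IsReal}))
        (∑ d ∈ Finset.range N, degProjS d ((schwartzTransport (euclE (Fin (n' + n') × {v : InfinitePlace (Fp L) // v.IsReal}))).symm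
          (schwartzTransport fr b)))) := fun N b => by
    simp only [Tr, T₁, T₂, T₄, T₅, ContinuousLinearMap.comp_apply, _root_.sum_apply, ContinuousLinearEquiv.coe_coe]
  let P : ℕ → Module.End ℂ ↥(piSchwartzBruhat (Fp L) (Fin (n' + n'))) := fun N =>
    adelicTensorEnd (Tr N : 𝓢(((Fin (n' + n')) → mixedSpace (Fp L)), ℂ) →ₗ[ℂ] 𝓢(((Fin (n' + n')) → mixedSpace (Fp L)), ℂ)) LinearMap.id
  have hP : ∀ (N : ℕ) (a : 𝓢(((Fin (n' + n')) → mixedSpace (Fp L)), ℂ)) (φ : FinSB (Fp L) (Fin (n' + n'))),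
      P N (E (a ⊗ₜ[ℂ] φ)) = E (Tr N a ⊗ₜ[ℂ] φ) := fun N a φ => adelicTensorEnd_apply_tmul _ _ a φ
  -- step 3: `P_N` commutes with `Π(k)`, `k ∈ 𝒦.K` (pure tensors by `hread` + ★ FILE 1, then everything by linearity)
  have hcomm : ∀ k ∈ 𝒦.K, ∀ (N : ℕ) (Φ : piSchwartzBruhat (Fp L) (Fin (n' + n'))), P N (R k Φ) = R k (P N Φ) := by
    intro k hk N
    obtain ⟨x, u, c, B, hxu, hk⟩ := hread k hk
    have hx : ∀ a : 𝓢(((Fin (n' + n')) → mixedSpace (Fp L)), ℂ), Tr N (carrierConjEquiv fr x.1.2 a) = carrierConjEquiv fr x.1.2 (Tr N a) := fun a =>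
      (hTr N _).trans ((degTrunc_carrierConjEquiv_of_proj_eq_realifySp fr hxu a N).trans (congrArg _ (hTr N a).symm))
    have hpure : ∀ (a : 𝓢(((Fin (n' + n')) → mixedSpace (Fp L)), ℂ)) (φ : FinSB (Fp L) (Fin (n' + n'))),
        P N (R k (E (a ⊗ₜ[ℂ] φ))) = R k (P N (E (a ⊗ₜ[ℂ] φ))) := fun a φ =>
      ((congrArg (P N) (hk a φ)).trans (((P N).map_smul c _).trans
        ((congrArg (fun y => c • y) (hP N _ _)).trans (congrArg (fun y => c • E (y ⊗ₜ[ℂ] B φ)) (hx a))))).trans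
        ((congrArg (R k) (hP N a φ)).trans (hk (Tr N a) φ)).symm
    have hext : (P N * R k).comp E.toLinearMap = (R k * P N).comp E.toLinearMap :=
      TensorProduct.ext' fun a φ => hpure a φ
    intro Φ
    have h := LinearMap.congr_fun hext (E.symm Φ)
    simpa only [LinearMap.comp_apply, LinearEquiv.coe_toLinearMap, LinearEquiv.apply_symm_apply, Module.End.mul_apply] using h
  -- step 2: the finite-dimensional stable `U ∋ E(v ⊗ f)` (★ U2f over a basis of `V`)
  let O : piSchwartzBruhat (Fp L) (Fin (n' + n')) → Submodule ℂ ↥(piSchwartzBruhat (Fp L) (Fin (n' + n'))) := fun Ψ =>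
    Submodule.span ℂ (Set.range fun k : 𝒦.K => ω (sB (tensorEmb L e dV hdV dW hdW eW e' dV' hdV' (k : HA L e dV hdV dW hdW))) Ψ)
  have hOfd : ∀ v ∈ V, FiniteDimensional ℂ (O (E (v ⊗ₜ[ℂ] f))) := fun v hv =>
    finiteDimensional_span_orbit_of_mem_span_tmul_of_isStd L e dV hdV dW hdW eW e' dV' hdV' hdV0 hdW0 hdV'0 h𝒦 hsB V hVst
      (Submodule.subset_span ⟨v, hv, f, rfl⟩)
  have hOself : ∀ Ψ : piSchwartzBruhat (Fp L) (Fin (n' + n')), Ψ ∈ O Ψ := fun Ψ =>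
    Submodule.subset_span ⟨⟨1, 𝒦.K.one_mem⟩, hRone Ψ⟩
  have hOst : ∀ k ∈ 𝒦.K, ∀ Ψ : piSchwartzBruhat (Fp L) (Fin (n' + n')), O Ψ ≤ (O Ψ).comap (R k) := fun k hk Ψ =>
    Submodule.span_le.2 (by
      rintro _ ⟨k', rfl⟩
      rw [SetLike.mem_coe, Submodule.mem_comap]
      exact (hRmul k k' Ψ) ▸ Submodule.subset_span ⟨⟨k * k', 𝒦.K.mul_mem hk k'.2⟩, rfl⟩)
  let b := Module.finBasis ℂ V
  let U : Submodule ℂ ↥(piSchwartzBruhat (Fp L) (Fin (n' + n'))) := ⨆ i, O (E (((b i : V) : 𝓢(((Fin (n' + n')) → mixedSpace (Fp L)), ℂ)) ⊗ₜ[ℂ] f))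
  haveI : ∀ i, FiniteDimensional ℂ (O (E (((b i : V) : 𝓢(((Fin (n' + n')) → mixedSpace (Fp L)), ℂ)) ⊗ₜ[ℂ] f))) := fun i => hOfd _ (b i).2
  haveI hUfd : FiniteDimensional ℂ U := Submodule.finiteDimensional_iSup _
  have hUst : ∀ k : 𝒦.K, ∀ w ∈ U, R k w ∈ U := fun k w hw =>
    (iSup_le fun i => (hOst k k.2 _).trans (Submodule.comap_mono (le_iSup (fun i =>
      O (E (((b i : V) : 𝓢(((Fin (n' + n')) → mixedSpace (Fp L)), ℂ)) ⊗ₜ[ℂ] f))) i)) : U ≤ U.comap (R k)) hw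
  have hEU : ∀ v ∈ V, E (v ⊗ₜ[ℂ] f) ∈ U := by
    intro v hv
    let ι : 𝓢(((Fin (n' + n')) → mixedSpace (Fp L)), ℂ) →ₗ[ℂ] ↥(piSchwartzBruhat (Fp L) (Fin (n' + n'))) :=
      E.toLinearMap.comp ((TensorProduct.mk ℂ 𝓢(((Fin (n' + n')) → mixedSpace (Fp L)), ℂ) (FinSB (Fp L) (Fin (n' + n')))).flip f)
    obtain ⟨c, hc⟩ : ∃ c : Fin (Module.finrank ℂ V) → ℂ, v = ∑ i, c i • ((b i : V) : 𝓢(((Fin (n' + n')) → mixedSpace (Fp L)), ℂ)) := by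
      refine ⟨fun i => b.repr ⟨v, hv⟩ i, ?_⟩
      have h := congrArg (Subtype.val : V → 𝓢(((Fin (n' + n')) → mixedSpace (Fp L)), ℂ)) (b.sum_repr ⟨v, hv⟩).symm
      simpa only [AddSubmonoidClass.coe_finsetSum, SetLike.val_smul] using h
    show ι v ∈ U
    rw [hc, map_sum]
    exact Submodule.sum_mem _ fun i _ => by
      rw [map_smul]
      exact Submodule.smul_mem _ _ (Submodule.mem_iSup_of_mem i (hOself _))
  -- step 4: the coefficient functional `λ` and the matrix-coefficient space of `U`
  -- the section at `h` is the value AT `1` of the section of `Π(h) Φ` (★ `swSectionTensor_mul_right`): a LINEAR functional of `Π(h) Φ`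
  let lam : ↥(piSchwartzBruhat (Fp L) (Fin (n' + n'))) →ₗ[ℂ] ℂ :=
    { toFun := fun Ψ => swSectionTensor L e dV hdV dW hdW eW e' dV' hdV' hdV0 hdW0 hdV'0 sB Ψ 1
      map_add' := fun Ψ Ψ' => swSectionTensor_add L e dV hdV dW hdW eW e' dV' hdV' hdV0 hdW0 hdV'0 sB Ψ Ψ' 1
      map_smul' := fun c Ψ => swSectionTensor_smul L e dV hdV dW hdW eW e' dV' hdV' hdV0 hdW0 hdV'0 sB c Ψ 1 }
  have hkey : ∀ (Φ : piSchwartzBruhat (Fp L) (Fin (n' + n'))) (h : HA L e dV hdV dW hdW),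
      swSectionTensor L e dV hdV dW hdW eW e' dV' hdV' hdV0 hdW0 hdV'0 sB Φ h = lam (R h Φ) := fun Φ h =>
    (congrArg (swSectionTensor L e dV hdV dW hdW eW e' dV' hdV' hdV0 hdW0 hdV'0 sB Φ) (one_mul h)).symm.trans
      (K2LiuSiegelWeilTensorGenerator.swSectionTensor_mul_right L e dV hdV hdV0 dW hdW hdW0 eW e' dV' hdV' hdV'0 sB Φ 1 h)
  let ρ : 𝒦.K → Module.End ℂ ↥(piSchwartzBruhat (Fp L) (Fin (n' + n'))) := fun k => R (k : HA L e dV hdV dW hdW)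
  haveI hMC := finiteDimensional_span_matrixCoeff ρ U (fun k w hw => hUst k w hw)
  -- step 1: Siegel sections are the images of their restrictions to `𝒦.K` under ONE linear map
  have hsec : ∀ Φ : piSchwartzBruhat (Fp L) (Fin (n' + n')), IsSiegelDeltaSection L e dV hdV dW hdW (χb ^ 3) ((((3 : ℕ) : ℂ) - (n : ℂ)) / 2)
      (swSectionTensor L e dV hdV dW hdW eW e' dV' hdV' hdV0 hdW0 hdV'0 sB Φ) := fun Φ =>
    isSiegelDeltaSection_swSectionTensor L e dV hdV dW hdW eW e' dV' hdV' hdV0 hdW0 hdV'0 three_ne_zero hsB Φ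
  choose pOf kOf hpk using 𝒦.iwasawa
  let Mx : (𝒦.K → ℂ) →ₗ[ℂ] (HA L e dV hdV dW hdW → ℂ) := LinearMap.pi fun h =>
    siegelDeltaCharacter L e dV hdV dW hdW (χb ^ 3) ((((3 : ℕ) : ℂ) - (n : ℂ)) / 2) (pOf h) • LinearMap.proj (⟨kOf h, (hpk h).2.1⟩ : 𝒦.K)
  have hM : ∀ φ : HA L e dV hdV dW hdW → ℂ, IsSiegelDeltaSection L e dV hdV dW hdW (χb ^ 3) ((((3 : ℕ) : ℂ) - (n : ℂ)) / 2) φ →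
      Mx (fun k => φ k) = φ := by
    intro φ hφ
    funext h
    rw [LinearMap.pi_apply, LinearMap.smul_apply, LinearMap.proj_apply, smul_eq_mul]
    conv_rhs => rw [(hpk h).2.2]
    exact (hφ _ (hpk h).1 _).symm
  -- assembly: every generator is `Mx` of a matrix coefficient of `U`
  refine Submodule.finiteDimensional_of_le (S₂ := (Submodule.span ℂ {ψ : 𝒦.K → ℂ | ∃ w ∈ U, ∃ ℓ : ↥(piSchwartzBruhat (Fp L) (Fin (n' + n'))) →ₗ[ℂ] ℂ,
    ψ = fun k => ℓ (ρ k w)}).map Mx) (Submodule.span_le.2 ?_)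
  rintro _ ⟨N, v, hv, rfl⟩
  refine ⟨fun k => lam (ρ k (P N (E (v ⊗ₜ[ℂ] f)))), matrixCoeff_comp_mem_span ρ U (fun k w _ => hcomm k k.2 N w) lam (hEU v hv), ?_⟩
  have h1 : P N (E (v ⊗ₜ[ℂ] f)) = E ((schwartzTransport fr).symm (schwartzTransport (euclE (Fin (n' + n') × {v : InfinitePlace (Fp L) // v.IsReal}))
      (∑ d ∈ Finset.range N, degProjS d ((schwartzTransport (euclE (Fin (n' + n') × {v : InfinitePlace (Fp L) // v.IsReal}))).symm
        (schwartzTransport fr v)))) ⊗ₜ[ℂ] f) := (hP N v f).trans (congrArg (fun y => E (y ⊗ₜ[ℂ] f)) (hTr N v))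
  have h2 : (fun k : 𝒦.K => lam (ρ k (P N (E (v ⊗ₜ[ℂ] f))))) = fun k : 𝒦.K =>
      swSectionTensor L e dV hdV dW hdW eW e' dV' hdV' hdV0 hdW0 hdV'0 sB (E ((schwartzTransport fr).symm
        (schwartzTransport (euclE (Fin (n' + n') × {v : InfinitePlace (Fp L) // v.IsReal}))
          (∑ d ∈ Finset.range N, degProjS d ((schwartzTransport (euclE (Fin (n' + n') × {v : InfinitePlace (Fp L) // v.IsReal}))).symm
            (schwartzTransport fr v)))) ⊗ₜ[ℂ] f)) (k : HA L e dV hdV dW hdW) :=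
    funext fun k => (congrArg (fun Ψ => lam (ρ k Ψ)) h1).trans (hkey _ _).symm
  exact (congrArg Mx h2).trans (hM _ (hsec _))

/-! ## §2 ★ p863249's (partner) letter from `𝒦.IsStd` and `hread` alone -/

/-- **THE (partner) LETTER OF ★ `K2LiuArchSWDataFinalPassage.forall_domain_good_of_archGenerators` AT `t := follandHermite frameD′`** for a STANDARD Iwasawa datum, from the
arch-leg reading letter `hread` alone: ★ p863527 `partner_letter_of_finiteRange` with its `hfin` paid by §1. [cite: KudlaRallis1994, §1 Thm. 1.1] [cite: Howe1989, §3]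
[cite: Folland1989, §1.7 (1.81)] -/
theorem partner_letter_of_isStd (h𝒦 : 𝒦.IsStd)
    (hread : ∀ k ∈ 𝒦.K, ∃ (x : MpS (Fin (n' + n') × {v : InfinitePlace (Fp L) // v.IsReal}))
      (u : Matrix.unitaryGroup (Fin (n' + n') × {v : InfinitePlace (Fp L) // v.IsReal}) ℂ) (c : ℂ)
      (B : FinSB (Fp L) (Fin (n' + n')) →ₗ[ℂ] FinSB (Fp L) (Fin (n' + n'))),
      MpS.proj x = realifySp (Fin (n' + n') × {v : InfinitePlace (Fp L) // v.IsReal}) u ∧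
      ∀ (a : 𝓢(((Fin (n' + n')) → mixedSpace (Fp L)), ℂ)) (φ : FinSB (Fp L) (Fin (n' + n'))),
        adelicMpCont.omega (Fp L) (Fin (n' + n')) (gramDA L e' dV hdV (tensorFrame L dW eW dV') (tensorFrame_real L dW hdW eW dV' hdV'))
            ((doubledWeilRep L e' dV hdV hdV0 (tensorFrame L dW eW dV') (tensorFrame_real L dW hdW eW dV' hdV')
                  (tensorFrame_ne_zero L dW eW dV' hdW0 hdV'0) χb hχbu hχbs) (tensorEmb L e dV hdV dW hdW eW e' dV' hdV' k))
            (piSchwartzBruhatEquiv (Fp L) (Fin (n' + n')) (a ⊗ₜ[ℂ] φ)) =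
          c • piSchwartzBruhatEquiv (Fp L) (Fin (n' + n'))
            (carrierConjEquiv (frameD L e' dV hdV hdV0 (tensorFrame L dW eW dV') (tensorFrame_real L dW hdW eW dV' hdV')
                (tensorFrame_ne_zero L dW eW dV' hdW0 hdV'0)) x.1.2 a ⊗ₜ[ℂ] B φ)) :
    ∀ (V : Submodule ℂ 𝓢(((Fin (n' + n')) → mixedSpace (Fp L)), ℂ)), FiniteDimensional ℂ V →
      IsArchStable L e dV hdV hdV0 dW hdW hdW0 eW e' dV' hdV' hdV'0 χb hχbu hχbs 𝒦 V →
      ∀ a ∈ V, ∀ f : FinSB (Fp L) (Fin (n' + n')), ∃ w ∈ Submodule.span ℂ (Set.range (follandHermite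
        (frameD L e' dV hdV hdV0 (tensorFrame L dW eW dV') (tensorFrame_real L dW hdW eW dV' hdV') (tensorFrame_ne_zero L dW eW dV' hdW0 hdV'0)))),
        genFamily L e dV hdV hdV0 dW hdW hdW0 eW e' dV' hdV' hdV'0 χb hχbu hχbs α 𝒦 (piSchwartzBruhatEquiv (Fp L) (Fin (n' + n')) (w ⊗ₜ[ℂ] f)) =
          genFamily L e dV hdV hdV0 dW hdW hdW0 eW e' dV' hdV' hdV'0 χb hχbu hχbs α 𝒦 (piSchwartzBruhatEquiv (Fp L) (Fin (n' + n')) (a ⊗ₜ[ℂ] f)) :=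
  partner_letter_of_finiteRange L e dV hdV hdV0 dW hdW hdW0 eW e' dV' hdV' hdV'0 χb hχbu hχbs α 𝒦 fun V hV hst f => by
    haveI := hV
    exact finiteDimensional_span_truncationSections L e dV hdV hdV0 dW hdW hdW0 eW e' dV' hdV' hdV'0 χb hχbu hχbs 𝒦 h𝒦 hread V hst f

end Summit.HodgeConjecture.HodgeConjecture.Cruxes.HLiu418.K2LiuArchSWTruncationSectionsFinite

end
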